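import Summits.QuantumFields.YangMills.Theorems.VirialFluxGapRingOrbitLinearisation
import Summits.QuantumFields.YangMills.Theorems.VirialFluxGapRingSignClassBookkeeping
import Summits.QuantumFields.YangMills.Theorems.VirialFluxGapRingOrbitSeparation
import Summits.QuantumFields.YangMills.Theorems.VirialFluxGapRingReferenceZero
import Summits.QuantumFields.YangMills.Theorems.VirialFluxGapRingZeroSetOrbits
import Summits.QuantumFields.YangMills.Theorems.TwistEaterVolumeQuadraticGrowth
import HarnessLib

/-!
# ★★★ Slice-free transversality at the twist-eater reference rings: chart coordinates are controlled by `√F_z` modulo gauge modes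
# (layer (B2/B3), the COERCIVITY input, of the DIRECT Laplace road to ⟨stmt-QuantumFields-24204⟩ `VirialFluxGap.SharpTwistedLaplace`)

Helper module (free-hands work of width seat ym-line-sfw-p2-w3 g56, cell ym-idea-1; `--supports 24204`).

THE STATEMENT (`exists_skew_linearised_le_sqrt_ringDeficit`).  `L ≥ 2`, `z ≠ 0`, reference data `(λ, N₀, C₀)` as in
✓`RingDeficit.ringDeficit_eq_zero_iff_exists_gauge_signClass`, a sign class `s`, `R_s = (combFlat w_s on every slice ; seam λ·C₀)`,
`w_s(k) = centreElem(s_k)·(N₀ if z_k else 1)`; `P` the ring with LEFT-chart coordinates `a = (A_{i,e}, B_x)` at `R_s`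
(`↑P_{i,e} = e^{A_{i,e}}·↑(combFlat w_s e)`, `↑P.2_x = e^{B_x}·↑(λ_x C₀)`), Frobenius norms `≤ m ≤ 1∕(32L³)`.  Then there is
`ξ : sites → 𝔰𝔲(2)` (skew-Hermitian, traceless) with

  `‖a + G_{R_s} ξ‖_{ℓ²} ≤ √(220000·L⁸·F_z(P)) + 2500·L⁴·(m² + 110000·L⁸·F_z(P))`,

`G_{R_s} ξ = (ξ_x − R_e ξ_y R_e⁻¹ ; ξ_x − g_x ξ_x g_x⁻¹)` the linearised gauge modes at `R_s`.

PROOF.  ✓`exists_flat_twisted_ring_near` (crux ⟨24320⟩ `QuadraticGrowth`, L. g15-A: an EXACT zero `Q` of `F_z` within `176L²√F_z(P)` of `P`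
per variable, no smallness needed) and ✓`ringDeficit_eq_zero_iff_exists_gauge_signClass` (`Q = h·R_{s'}`).  If `s' = s` or `s' = flip_z(s)`
(all twisted signs flipped) then `R_{s'} = c·R_s·c⁻¹` with the constant `c ∈ {1, C₀}` (✓`signClass_relations`), the gauge field `c⁻¹h⁻¹` moves
`P` to within `176L²√F` per variable of `R_s` (`ringDist ≤ (7/2)L⁴·(176L²√F)² ≤ 110000L⁸F`, `ringDist_le_of_fd_le`), and
✓`exists_skew_linearised_gauge_le` (Theorem A of `…RingOrbitLinearisation`) concludes.  Otherwise the sign-class invariants differ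
(`signClass_invariants_ne`), ✓`ringDist_ge_of_invariants_ne` gives `1/(18L) ≤ ringDist(h⁻¹·R_s, R_{s'}) ≤ (7/2)L⁴((3/2)m + 176L²√F)²`, which
with `m ≤ 1/(32L³)` forces `m ≤ 176L²√F` (`far_class_aux`), and `ξ = 0` does it (`‖a‖²_{ℓ²} ≤ 7L⁴m²`, `chart_sq_sum_le`).

CONSUMPTION (the `hcoer` ∕ `κ` of the road).  For a linear slice `V` through `R_s` at angle `θ` to the gauge modes `{−G_{R_s}ξ}`:
`sin θ·‖y‖ ≤ ‖ι y + G ξ‖` for all `ξ`, hence `sin θ‖y‖ ≤ √(220000L⁸F_z(σ y)) + 2500L⁴(‖y‖² + 110000L⁸F_z(σ y))`, i.e.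
`F_z(σ(y)) ≥ κ‖y‖²` with `κ = sin²θ∕poly(L)` on `‖y‖ ≤ sin θ∕poly(L)` — the input of ✓`QuantitativeLaplace.coercive_of_quadratic_growth`,
with NO lattice Poincaré inequality and no Hessian computation.

Everything here is PROVED; no definitions, no named facts (namespace `Summit.QuantumFields.YangMills.Theorems.VirialFluxGap.ChartPhase`).
HONEST FRAMING: lattice gauge bookkeeping over landed results; ⟨24204⟩, ⟨24319⟩ and every rung stay OPEN; the Yang–Mills mass gap (Clay) is
NOT touched; no summit is proved by a line.

## References
* M. Lüscher, Nucl. Phys. B219 (1983), §2 (twist-eating flat connections; their rigidity). [Luscher1983]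
* A. González-Arroyo, C. P. Korthals Altes, Nucl. Phys. B311 (1988), §2. [GonzalezarroyoAltes1988]
-/

set_option autoImplicit false

noncomputable section

open scoped Matrix Matrix.Norms.Frobenius BigOperators
open NormedSpace
open Literature.MathematicalPhysics.QuantumFieldTheory hiding SU2
open Literature.MathematicalPhysics.QuantumLattice
open Summit.QuantumFields.YangMills.Theorems.FemtoTransferGap
open Summit.QuantumFields.YangMills.Theorems.FemtoTransferGap.TT
open Summit.QuantumFields.YangMills.Theorems.FemtoTransferGap.TwoLattice
open Summit.QuantumFields.YangMills.Theorems.FemtoTransferGap.TwoLattice.Flat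
open Summit.QuantumFields.YangMills.Theorems.FemtoTransferGap.TwoLattice.Cov
open Summit.QuantumFields.YangMills.Theorems.ToronValleyVolume.Lojasiewicz
open Summit.QuantumFields.YangMills.Theorems.TwistEaterVolume.Quadratic
open Summit.QuantumFields.YangMills.Theorems.VirialFluxGap.RingDeficit
open Summit.QuantumFields.YangMills.Theorems.ColdBoxAllGroups (norm_exp_sub_one_sub_le norm_exp_sub_one_le')

namespace Summit.QuantumFields.YangMills.Theorems.VirialFluxGap.ChartPhase

variable {L : ℕ} [NeZero L]
set_option maxHeartbeats 400000 in
/-- ★★★ **Slice-free transversality at the reference twist-eater rings.**  `L ≥ 2`, `z ≠ 0`, reference data `(λ, N₀, C₀)` as in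
✓`ringDeficit_eq_zero_iff_exists_gauge_signClass`, a sign class `s` with reference ring `R_s = (combFlat w_s ; λ·C₀)`,
`w_s(k) = centreElem(s_k)·(N₀ if z_k else 1)`; `P` the ring with LEFT-chart coordinates `a = (A, B)` at `R_s`, Frobenius norms `≤ m ≤ 1∕(32L³)`.
Then there is `ξ : sites → 𝔰𝔲(2)` with

  `‖a + G_{R_s} ξ‖_{ℓ²} ≤ √(220000·L⁸·F_z(P)) + 2500·L⁴·(m² + 110000·L⁸·F_z(P))`.

PROOF.  ✓`exists_flat_twisted_ring_near` (⟨24320⟩: a zero `Q` within `176L²√F` per variable) and ✓`ringDeficit_eq_zero_iff_exists_gauge_signClass`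
(`Q = h·R_{s'}`); if `s' ∈ {s, flip_z s}` then `R_{s'} = c·R_s·c⁻¹` (`c ∈ {1, C₀}`, ✓`signClass_relations`) and ✓`exists_skew_linearised_gauge_le`
with the gauge field `c⁻¹h⁻¹` and `D ≤ (7/2)L⁴(176L²√F)²`; otherwise the invariants differ (✓`signClass_invariants_ne`) and
✓`ringDist_ge_of_invariants_ne` forces `176L²√F ≥ m`, so `ξ = 0` does it.

CONSUMPTION: for a linear slice `V` at angle `θ` to the gauge modes this is `F_z(σ(y)) ≥ κ‖y‖²`, `κ = sin²θ∕poly(L)`, on `‖y‖ ≤ sin θ∕poly(L)` —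
the input of ✓`coercive_of_quadratic_growth` ∕ the `hcoer` of ✓`laplaceMethod_quantitative_orbit`. [cite: Luscher1983, §2]
[cite: GonzalezarroyoAltes1988, §2] -/
theorem exists_skew_linearised_le_sqrt_ringDeficit (hL : 2 ≤ L) (z : Fin 3 → Bool) (hz : z ≠ fun _ => false)
    {lam : Site 3 L → SU2} (hlamc : ∀ x, lam x ∈ Subgroup.center SU2) (hlam0 : lam 0 = 1)
    (hlamflip : ∀ (x : Site 3 L) (k : Fin 3), (x k = 0 ∨ x k = -1) → lam (x.shift k) = lam x * centreElem (z k))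
    (hlamstay : ∀ (x : Site 3 L) (k : Fin 3), x k ≠ 0 → x k ≠ -1 → lam (x.shift k) = lam x)
    {N₀ C₀ : SU2} (hN : (su2Quat N₀).re = 0) (hC : (su2Quat C₀).re = 0)
    (hNC : (su2Quat N₀).imI * (su2Quat C₀).imI + (su2Quat N₀).imJ * (su2Quat C₀).imJ + (su2Quat N₀).imK * (su2Quat C₀).imK = 0)
    (s : Fin 3 → Bool) {m : ℝ} (hm : m ≤ 1 / (32 * (L : ℝ) ^ 3))
    {A : Fin (2 * L - 1 + 1) → Edge 3 L → Matrix (Fin 2) (Fin 2) ℂ} {B : Site 3 L → Matrix (Fin 2) (Fin 2) ℂ}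
    (hA : ∀ i e, ‖A i e‖ ≤ m) (hB : ∀ x, ‖B x‖ ≤ m)
    {P : (Fin (2 * L - 1 + 1) → GaugeConfig 3 L SU2) × (Site 3 L → SU2)}
    (hP1 : ∀ i e, (P.1 i e : Matrix (Fin 2) (Fin 2) ℂ) =
      exp (A i e) * ((combFlat (fun k => centreElem (s k) * (if z k then N₀ else 1)) e : SU2) : Matrix (Fin 2) (Fin 2) ℂ))
    (hP2 : ∀ x, (P.2 x : Matrix (Fin 2) (Fin 2) ℂ) = exp (B x) * ((lam x * C₀ : SU2) : Matrix (Fin 2) (Fin 2) ℂ)) :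
    ∃ ξ : Site 3 L → Matrix (Fin 2) (Fin 2) ℂ, (∀ x, (ξ x)ᴴ = -ξ x) ∧ (∀ x, (ξ x).trace = 0) ∧
      Real.sqrt ((∑ i : Fin (2 * L - 1 + 1), ∑ e : Edge 3 L,
            ‖A i e + (ξ e.1 - ((combFlat (fun k => centreElem (s k) * (if z k then N₀ else 1)) e : SU2) : Matrix (Fin 2) (Fin 2) ℂ) *
              ξ (e.1.shift e.2) * ((combFlat (fun k => centreElem (s k) * (if z k then N₀ else 1)) e : SU2) : Matrix (Fin 2) (Fin 2) ℂ)ᴴ)‖ ^ 2) +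
          ∑ x : Site 3 L, ‖B x + (ξ x - ((lam x * C₀ : SU2) : Matrix (Fin 2) (Fin 2) ℂ) * ξ x * ((lam x * C₀ : SU2) : Matrix (Fin 2) (Fin 2) ℂ)ᴴ)‖ ^ 2) ≤
        Real.sqrt (220000 * (L : ℝ) ^ 8 * ringDeficit L z P) +
          2500 * (L : ℝ) ^ 4 * (m ^ 2 + 110000 * (L : ℝ) ^ 8 * ringDeficit L z P) := by
  set w : Fin 3 → SU2 := fun k => centreElem (s k) * (if z k then N₀ else 1) with hw
  set Rs : (Fin (2 * L - 1 + 1) → GaugeConfig 3 L SU2) × (Site 3 L → SU2) := (fun _ => combFlat w, fun x => lam x * C₀) with hRs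
  set F : ℝ := ringDeficit L z P with hF
  have hF0 : 0 ≤ F := ringDeficit_nonneg z P
  have hsF0 : 0 ≤ Real.sqrt F := Real.sqrt_nonneg F
  have hsF2 : Real.sqrt F ^ 2 = F := Real.sq_sqrt hF0
  have hL1 : (1 : ℝ) ≤ (L : ℝ) := by exact_mod_cast NeZero.one_le
  have hL2 : (2 : ℝ) ≤ (L : ℝ) := by exact_mod_cast hL
  have hL0 : (0 : ℝ) < (L : ℝ) := by linarith
  have hm0 : 0 ≤ m := (norm_nonneg _).trans (hB 0)
  have hm4 : m ≤ 1 / 4 := by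
    refine hm.trans (one_div_le_one_div_of_le (by norm_num) ?_)
    nlinarith [pow_le_pow_left₀ (by norm_num : (0:ℝ) ≤ 2) hL2 3]
  have hlcomm : ∀ (x : Site 3 L) (a : SU2), lam x * a = a * lam x := fun x a => centre_comm (hlamc x) a
  have hfd0 : ∀ U V : SU2, 0 ≤ fd U V := fun U V => by unfold fd; rw [frobNorm_eq_norm]; exact norm_nonneg _
  -- the chart displacement per variable
  have hRP1 : ∀ i e, fd (combFlat w e) (P.1 i e) ≤ 3 / 2 * m := fun i e => fd_le_of_coe_eq_exp_mul hm4 (hA i e) (hP1 i e)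
  have hRP2 : ∀ x, fd (lam x * C₀) (P.2 x) ≤ 3 / 2 * m := fun x => fd_le_of_coe_eq_exp_mul hm4 (hB x) (hP2 x)
  -- a zero near `P`, and its class
  obtain ⟨Q, hQ0, hQ1, hQ2⟩ := exists_flat_twisted_ring_near hL z hz P
  obtain ⟨s', h, hQ⟩ := (ringDeficit_eq_zero_iff_exists_gauge_signClass hL z hz hlamc hlam0 hlamflip hlamstay hN hC hNC Q).mp hQ0
  set w' : Fin 3 → SU2 := fun k => centreElem (s' k) * (if z k then N₀ else 1) with hw'
  have hQ1e : ∀ i e, Q.1 i e = h e.1 * combFlat w' e * (h (e.1.shift e.2))⁻¹ := fun i e => by rw [hQ]; rfl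
  have hQ2x : ∀ x, Q.2 x = h x * (lam x * C₀) * (h x)⁻¹ := fun x => by rw [hQ]; rfl
  have hQ1' : ∀ i e, combFlat w' e = (h e.1)⁻¹ * Q.1 i e * h (e.1.shift e.2) := fun i e => by
    rw [hQ1e i e]; group
  have hQ2' : ∀ x, lam x * C₀ = (h x)⁻¹ * Q.2 x * h x := fun x => by rw [hQ2x x]; group
  -- KEY: the near classes `s' = s` or `s' = flip s`, through a constant `c ∈ {1, C₀}` with `R_{s'} = c·R_s·c⁻¹`
  have key : ∀ c : SU2, (∀ k, w' k = c * w k * c⁻¹) → (∀ x, c * (lam x * C₀) * c⁻¹ = lam x * C₀) →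
      ∃ ξ : Site 3 L → Matrix (Fin 2) (Fin 2) ℂ, (∀ x, (ξ x)ᴴ = -ξ x) ∧ (∀ x, (ξ x).trace = 0) ∧
        Real.sqrt ((∑ i : Fin (2 * L - 1 + 1), ∑ e : Edge 3 L,
            ‖A i e + (ξ e.1 - ((combFlat w e : SU2) : Matrix (Fin 2) (Fin 2) ℂ) * ξ (e.1.shift e.2) * ((combFlat w e : SU2) : Matrix (Fin 2) (Fin 2) ℂ)ᴴ)‖ ^ 2) +
          ∑ x : Site 3 L, ‖B x + (ξ x - ((lam x * C₀ : SU2) : Matrix (Fin 2) (Fin 2) ℂ) * ξ x * ((lam x * C₀ : SU2) : Matrix (Fin 2) (Fin 2) ℂ)ᴴ)‖ ^ 2) ≤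
        Real.sqrt (220000 * (L : ℝ) ^ 8 * F) + 2500 * (L : ℝ) ^ 4 * (m ^ 2 + 110000 * (L : ℝ) ^ 8 * F) := by
    intro c hc1 hc2
    set h' : Site 3 L → SU2 := fun x => c⁻¹ * (h x)⁻¹ with hh'
    have hR0 : ringDeficit L z Rs = 0 := ringDeficit_reference_eq_zero hL z hlamc hlamflip hlamstay hN hC hNC s
    obtain ⟨ξ, hξ1, hξ2, hb⟩ := exists_skew_linearised_gauge_le (R := Rs) hL hz hR0 (fun _ => rfl) hm4 hA hB (P := P) hP1 hP2 h'
    set DA : ℝ := (∑ i, (6 * (L : ℝ) ^ 3 - timeCoupling su2Rep (gaugeTransform h' (P.1 i)) (Rs.1 i))) +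
        ∑ x, (2 - ((su2Rep ((h' * P.2 * h'⁻¹) x * (Rs.2 x)⁻¹)).trace).re) with hDA
    refine ⟨ξ, hξ1, hξ2, hb.trans ?_⟩
    -- the distance after the gauge transformation `h' = c⁻¹h⁻¹` is the distance from `P` to `Q`
    have hlinks : ∀ i e, fd (gaugeTransform h' (P.1 i) e) (Rs.1 i e) ≤ 176 * (L : ℝ) ^ 2 * Real.sqrt F := by
      intro i e
      have e1 : gaugeTransform h' (P.1 i) e = c⁻¹ * ((h e.1)⁻¹ * P.1 i e * h (e.1.shift e.2)) * c := by
        show c⁻¹ * (h e.1)⁻¹ * P.1 i e * (c⁻¹ * (h (e.1.shift e.2))⁻¹)⁻¹ = _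
        group
      have e2 : Rs.1 i e = c⁻¹ * combFlat w' e * c := by
        show combFlat w e = _
        rw [← conj_combFlat_apply hc1 e]; group
      rw [e1, e2, fd_mul_right, fd_mul_left, hQ1' i e, fd_mul_right, fd_mul_left]
      exact hQ1 i e
    have hsites : ∀ x, fd ((h' * P.2 * h'⁻¹) x) (Rs.2 x) ≤ 176 * (L : ℝ) ^ 2 * Real.sqrt F := by
      intro x
      have e1 : (h' * P.2 * h'⁻¹) x = c⁻¹ * ((h x)⁻¹ * P.2 x * h x) * c := by
        show c⁻¹ * (h x)⁻¹ * P.2 x * (c⁻¹ * (h x)⁻¹)⁻¹ = _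
        group
      have e2 : Rs.2 x = c⁻¹ * (lam x * C₀) * c := by
        show lam x * C₀ = _
        calc lam x * C₀ = c⁻¹ * (c * (lam x * C₀) * c⁻¹) * c := by group
          _ = c⁻¹ * (lam x * C₀) * c := by rw [hc2 x]
      rw [e1, e2, fd_mul_right, fd_mul_left, hQ2' x, fd_mul_right, fd_mul_left]
      refine (hQ2 x).trans ?_
      nlinarith [hsF0, sq_nonneg (L : ℝ)]
    have hD := ringDist_le_of_fd_le (X := (fun i => gaugeTransform h' (P.1 i), h' * P.2 * h'⁻¹)) (Y := Rs)
      (by positivity : (0 : ℝ) ≤ 176 * (L : ℝ) ^ 2 * Real.sqrt F) hlinks hsites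
    have hD' : DA ≤ 110000 * (L : ℝ) ^ 8 * F := by
      refine hD.trans ?_
      have : 7 / 2 * (L : ℝ) ^ 4 * (176 * (L : ℝ) ^ 2 * Real.sqrt F) ^ 2 = 108416 * (L : ℝ) ^ 8 * F := by
        rw [mul_pow, mul_pow, hsF2]; ring
      rw [this]
      nlinarith [pow_nonneg hL0.le 8]
    have h1 : Real.sqrt (2 * DA) ≤ Real.sqrt (220000 * (L : ℝ) ^ 8 * F) := Real.sqrt_le_sqrt (by linarith)
    have h2 : 2500 * (L : ℝ) ^ 4 * (m ^ 2 + DA) ≤ 2500 * (L : ℝ) ^ 4 * (m ^ 2 + 110000 * (L : ℝ) ^ 8 * F) :=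
      mul_le_mul_of_nonneg_left (by linarith) (by positivity)
    exact add_le_add h1 h2
  -- case analysis on the class `s'`
  by_cases hi : ∀ k, s' k = s k
  · refine key 1 (fun k => ?_) (fun x => by rw [one_mul, inv_one, mul_one])
    rw [one_mul, inv_one, mul_one, hw', hw]; simp only [hi k]
  by_cases hii : (∀ k, z k = false → s' k = s k) ∧ (∀ k, z k = true → s' k ≠ s k)
  · obtain ⟨-, hcw⟩ := signClass_relations z s hN hC hNC
    refine key C₀ (fun k => ?_) (fun x => ?_)
    · rw [hw', hw]; dsimp only
      rw [hcw k]
      exact signClass_flip_wraps hii.1 hii.2 (fun k => if z k then N₀ else 1) k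
    · rw [← mul_assoc, mul_assoc (C₀ * lam x), mul_inv_cancel, mul_one, hlcomm x C₀]
  -- far classes: the deficit is large, `ξ = 0` suffices
  have hne := signClass_invariants_ne (N₀ := N₀) hi hii
  obtain ⟨k₀, hk₀⟩ : ∃ k, z k = true := by
    by_contra hcon
    push Not at hcon
    exact hz (funext fun k => by simpa using hcon k)
  obtain ⟨hww, hcw⟩ := signClass_relations z s hN hC hNC
  obtain ⟨hww', hcw'⟩ := signClass_relations z s' hN hC hNC
  have hsep := ringDist_ge_of_invariants_ne hL z k₀ hk₀ hww hcw hww' hcw' hne (fun x => lam x * C₀) (fun x => lam x * C₀)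
    (fun x => (h x)⁻¹)
  set τ : ℝ := 3 / 2 * m + 176 * (L : ℝ) ^ 2 * Real.sqrt F with hτ
  have hτ0 : 0 ≤ τ := by positivity
  have hup := ringDist_le_of_fd_le
    (X := (fun _ : Fin (2 * L - 1 + 1) => gaugeTransform (fun x => (h x)⁻¹) (combFlat w),
      (fun x => (h x)⁻¹) * (fun x => lam x * C₀) * (fun x => (h x)⁻¹)⁻¹))
    (Y := (fun _ : Fin (2 * L - 1 + 1) => combFlat w', fun x => lam x * C₀)) hτ0
    (fun i e => by
      show fd ((h e.1)⁻¹ * combFlat w e * ((h (e.1.shift e.2))⁻¹)⁻¹) (combFlat w' e) ≤ τ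
      rw [inv_inv, hQ1' i e, fd_mul_right, fd_mul_left]
      exact (fd_triangle _ (P.1 i e) _).trans (add_le_add (hRP1 i e) (hQ1 i e)))
    (fun x => by
      show fd ((h x)⁻¹ * (lam x * C₀) * ((h x)⁻¹)⁻¹) (lam x * C₀) ≤ τ
      have e1 : fd ((h x)⁻¹ * (lam x * C₀) * ((h x)⁻¹)⁻¹) (lam x * C₀) = fd (lam x * C₀) (Q.2 x) := by
        conv_lhs => rw [inv_inv]; arg 2; rw [hQ2' x]
        rw [fd_mul_right, fd_mul_left]
      rw [e1]
      refine (fd_triangle _ (P.2 x) _).trans ((add_le_add (hRP2 x) (hQ2 x)).trans ?_)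
      rw [hτ]; nlinarith [hsF0, sq_nonneg (L : ℝ)])
  -- `1/(18L) ≤ (7/2)L⁴τ²` forces `m ≤ 176L²√F`
  have hlow : 1 / (18 * (L : ℝ)) ≤ 7 / 2 * (L : ℝ) ^ 4 * τ ^ 2 := hsep.trans hup
  have hmu : m ≤ 176 * (L : ℝ) ^ 2 * Real.sqrt F := far_class_aux hL1 hm hsF0 hτ hlow
  -- `ξ = 0`
  refine ⟨fun _ => 0, fun _ => by simp, fun _ => by simp, ?_⟩
  simp only [Matrix.mul_zero, Matrix.zero_mul, sub_zero, add_zero]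
  have hsum := chart_sq_sum_le hA hB
  have h7 : 7 * (L : ℝ) ^ 4 * m ^ 2 ≤ 220000 * (L : ℝ) ^ 8 * F := far_class_aux' hm0 hsF2 hmu
  calc Real.sqrt ((∑ i : Fin (2 * L - 1 + 1), ∑ e : Edge 3 L, ‖A i e‖ ^ 2) + ∑ x : Site 3 L, ‖B x‖ ^ 2)
      ≤ Real.sqrt (220000 * (L : ℝ) ^ 8 * F) := Real.sqrt_le_sqrt (hsum.trans h7)
    _ ≤ Real.sqrt (220000 * (L : ℝ) ^ 8 * F) + 2500 * (L : ℝ) ^ 4 * (m ^ 2 + 110000 * (L : ℝ) ^ 8 * F) :=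
        le_add_of_nonneg_right (by positivity)

end Summit.QuantumFields.YangMills.Theorems.VirialFluxGap.ChartPhase
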